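import Summits.NavierStokesRegularity.OSWSelfSimilar.SheetREnergyClass
import Literature.Analysis.FluidPDE.RadialSmoothCutoff
import HarnessLib

/-!
# SHEET-ℝ frame, linearised operator: the weak form, the compactly supported test class, and the cutoff test functions
# `χ_R u`, `χ_R² u` of an energy-class profile

HONEST FRAMING (cell ns-blowup GROUP B / zone Z3, cases Z3-SR-CERT / Z3-SR-SPEC; 1-D MODEL certificate frame (viscous gCLM/OSW sheet
on the line); not Euler/NS; «violates: none — MODEL»). Nothing here asserts that a profile exists.

The certificate's linear part is `DG(Ω̄) = B_λ − P` with the LOCAL second-order operator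
`B_λ = B₀ + a𝒰̄∂ − HΩ̄ + λχ = −∂² + d(ξ)∂ + V(ξ)`, `d = ½ξ + a𝒰̄`, `V = 1 − HΩ̄ + λχ` (`CertificateViscousSheetR`, FRAME); its
`½ξ∂` part is NOT a bounded bilinear form on the energy space `E = H¹_w` (selfsim g9, STATUS 2026-08-27 00:10Z), so «the inverse
`S = B_λ⁻¹ : L²_w → E`» has to be produced from a WEAK formulation against compactly supported tests (Lions' theorem in operator form,
`Literature.Analysis.OperatorTheory.exists_solutionOperator_of_coercive`) plus a UNIQUENESS theorem for weak solutions in `E`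
(`Literature.Analysis.OperatorTheory.eq_of_approx`, whose hypothesis is an approximation of `u ∈ E` by tests with vanishing commutator).
This file fixes the vocabulary and builds the approximating tests:

* `linForm L d V u u₁ φ φ₁ = ∫ [w u₁φ₁ + 2ξ u₁φ + w d u₁φ + w V uφ]`, `w = L² + ξ²` — the weak form `⟨(−∂² + d∂ + V)u, wφ⟩` in the
  primitive variables of record (`u = u(0) + ∫₀u₁`, `φ = φ(0) + ∫₀φ₁`; `(wφ)′ = 2ξφ + wφ₁`);
* `IsCompactTest v v₁` — `v` odd, `v = v(0) + ∫₀v₁`, `v₁ ∈ L²`, and `v, v₁` vanish pointwise off a bounded set;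
* `cutoff R ξ = smoothTransition (2 − ξ²/R²)` (the tree's `Literature.Analysis.FluidPDE` radial cutoff on `ℝ`): even, `C¹`, values in
  `[0,1]`, `= 1` on `ξ² ≤ R²`, `= 0` on `2R² ≤ ξ²`, `|χ_R′| ≤ M/R` with ONE `M` for all `R`, `χ_R′ = 0` off `R² ≤ ξ² ≤ 2R²`;
* `primitive_mul` — the product rule in primitive form (`χ ∈ C¹`, `u = u(0) + ∫₀u₁`, `u₁ ∈ L²` ⇒ `χu = (χu)(0) + ∫₀(χ′u + χu₁)`, by the
  absolutely continuous calculus), and `isCompactTest_cutoff_mul`: for `u` in the (odd, `L²`) class, `(χ_R u, χ_R′u + χ_R u₁)` is a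
  compactly supported test; iterating, so is `χ_R² u`.
The uniqueness theorem itself is `SheetRLinearisedUniqueness.lean`. Pure calculus; two definitions (`linForm`, `cutoff`) and one hypothesis structure (`IsCompactTest`), no
named fact. WHAT THIS IS NOT: not NS; no number of record moves.
-/

noncomputable section

namespace Summit.NavierStokesRegularity.OSWSelfSimilar
namespace SheetRLinearisedTests

open _root_.MeasureTheory _root_.Set _root_.Filter _root_.Real SheetRWeakProfilePV SheetREnergyClass
open scoped Topology

/-! ### §1 Vocabulary -/

/-- **The linearised weak form** in the primitive variables: for coefficients `d, V` (drift, potential), a profile `(u, u₁)` and a test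
`(φ, φ₁)`, `linForm L d V u u₁ φ φ₁ = ∫ [(L²+ξ²)u₁φ₁ + 2ξu₁φ + (L²+ξ²)d u₁φ + (L²+ξ²)V uφ] dξ` — the pairing `⟨(−∂² + d∂ + V)u, (L²+ξ²)φ⟩`
after one integration by parts. (Bochner integral: `0` if the integrand is not integrable; every use below proves integrability.) [folklore] -/
def linForm (L : ℝ) (d V u u₁ φ φ₁ : ℝ → ℝ) : ℝ :=
  ∫ ξ, ((L ^ 2 + ξ ^ 2) * (u₁ ξ * φ₁ ξ) + 2 * ξ * (u₁ ξ * φ ξ) + (L ^ 2 + ξ ^ 2) * d ξ * (u₁ ξ * φ ξ)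
    + (L ^ 2 + ξ ^ 2) * V ξ * (u ξ * φ ξ))

/-- **Compactly supported odd energy-class tests** `(v, v₁)`: `v = v(0) + ∫₀v₁`, `v` odd, `v₁ ∈ L²`, and `v`, `v₁` vanish pointwise
where `R ≤ |ξ|` for some `R`. [folklore] -/
structure IsCompactTest (v v₁ : ℝ → ℝ) : Prop where
  /-- primitive form `v = v(0) + ∫₀ v₁` -/
  primitive : ∀ x, v x = v 0 + ∫ s in (0 : ℝ)..x, v₁ s
  /-- `v` is odd -/
  odd : ∀ y, v (-y) = -v y
  /-- `v₁ ∈ L²` -/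
  memLp : MemLp v₁ 2 volume
  /-- `v` and `v₁` vanish off a bounded set -/
  support : ∃ R : ℝ, ∀ x, R ≤ |x| → v x = 0 ∧ v₁ x = 0

/-- **The cutoff at scale `R`**: `χ_R(ξ) = smoothTransition (2 − ‖ξ‖²/R²)` (the tree's radial smooth cutoff, on `ℝ`). [folklore] -/
def cutoff (R ξ : ℝ) : ℝ := smoothTransition (2 - ‖ξ‖ ^ 2 / R ^ 2)

/-! ### §2 The cutoff: plateau, support, parity, derivative bound -/

/-- `χ_R` is the tree's cutoff `y ↦ smoothTransition (2 − ‖y‖²/R²)` on `E = ℝ`. [folklore] -/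
theorem cutoff_eq (R : ℝ) : cutoff R = fun ξ : ℝ => smoothTransition (2 - ‖ξ‖ ^ 2 / R ^ 2) := rfl

/-- `χ_R ∈ C¹`. [folklore] -/
theorem contDiff_cutoff (R : ℝ) : ContDiff ℝ 1 (cutoff R) := by
  rw [cutoff_eq]; exact Literature.Analysis.FluidPDE.contDiff_smoothTransition_cutoff (E := ℝ) (n := 1) R

/-- `χ_R` is even. [folklore] -/
theorem cutoff_neg (R ξ : ℝ) : cutoff R (-ξ) = cutoff R ξ := by simp [cutoff, norm_neg]

/-- `0 ≤ χ_R ≤ 1`. [folklore] -/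
theorem cutoff_nonneg_le_one (R ξ : ℝ) : 0 ≤ cutoff R ξ ∧ cutoff R ξ ≤ 1 :=
  ⟨Real.smoothTransition.nonneg _, Real.smoothTransition.le_one _⟩

/-- Plateau: `χ_R(ξ) = 1` when `ξ² ≤ R²` (`R > 0`). [folklore] -/
theorem cutoff_eq_one {R ξ : ℝ} (hR : 0 < R) (h : ξ ^ 2 ≤ R ^ 2) : cutoff R ξ = 1 := by
  unfold cutoff
  apply Real.smoothTransition.one_of_one_le
  rw [Real.norm_eq_abs, sq_abs]
  have : ξ ^ 2 / R ^ 2 ≤ 1 := by rw [div_le_one (by positivity)]; exact h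
  linarith

/-- Support: `χ_R(ξ) = 0` when `2R² ≤ ξ²` (`R > 0`). [folklore] -/
theorem cutoff_eq_zero {R ξ : ℝ} (hR : 0 < R) (h : 2 * R ^ 2 ≤ ξ ^ 2) : cutoff R ξ = 0 := by
  unfold cutoff
  apply Real.smoothTransition.zero_of_nonpos
  rw [Real.norm_eq_abs, sq_abs]
  have : 2 ≤ ξ ^ 2 / R ^ 2 := by rw [le_div_iff₀ (by positivity)]; exact h
  linarith

/-- `χ_R′ = 0` inside the plateau: `ξ² < R²` ⇒ `deriv χ_R ξ = 0`. [folklore] -/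
theorem deriv_cutoff_eq_zero_of_lt {R ξ : ℝ} (hR : 0 < R) (h : ξ ^ 2 < R ^ 2) : deriv (cutoff R) ξ = 0 := by
  have hev : cutoff R =ᶠ[𝓝 ξ] fun _ => (1 : ℝ) := by
    have hopen : IsOpen {y : ℝ | y ^ 2 < R ^ 2} := isOpen_lt (by fun_prop) continuous_const
    filter_upwards [hopen.mem_nhds h] with y hy
    exact cutoff_eq_one hR (le_of_lt hy)
  rw [hev.deriv_eq, deriv_const]

/-- `χ_R′ = 0` outside the support: `2R² < ξ²` ⇒ `deriv χ_R ξ = 0`. [folklore] -/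
theorem deriv_cutoff_eq_zero_of_gt {R ξ : ℝ} (hR : 0 < R) (h : 2 * R ^ 2 < ξ ^ 2) : deriv (cutoff R) ξ = 0 := by
  have hev : cutoff R =ᶠ[𝓝 ξ] fun _ => (0 : ℝ) := by
    have hopen : IsOpen {y : ℝ | 2 * R ^ 2 < y ^ 2} := isOpen_lt continuous_const (by fun_prop)
    filter_upwards [hopen.mem_nhds h] with y hy
    exact cutoff_eq_zero hR (le_of_lt hy)
  rw [hev.deriv_eq, deriv_const]

/-- `χ_R` and `χ_R′` vanish where `2R ≤ |ξ|` (`R > 0`). [folklore] -/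
theorem cutoff_and_deriv_eq_zero {R ξ : ℝ} (hR : 0 < R) (h : 2 * R ≤ |ξ|) :
    cutoff R ξ = 0 ∧ deriv (cutoff R) ξ = 0 := by
  have h4 : 4 * R ^ 2 ≤ ξ ^ 2 := by
    rw [← sq_abs ξ]; nlinarith [abs_nonneg ξ]
  have hR2 : 0 < R ^ 2 := by positivity
  exact ⟨cutoff_eq_zero hR (by linarith), deriv_cutoff_eq_zero_of_gt hR (by linarith)⟩

/-- **Uniform derivative bound**: one constant `M ≥ 0` with `|χ_R′(ξ)| ≤ M/R` for every `R > 0` and `ξ` (scaling of the unit cutoff;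
the tree's `exists_norm_fderiv_smoothTransition_cutoff_le` on `ℝ`). [folklore] -/
theorem exists_deriv_cutoff_le : ∃ M : ℝ, 0 ≤ M ∧ ∀ R : ℝ, 0 < R → ∀ ξ : ℝ, |deriv (cutoff R) ξ| ≤ M / R := by
  obtain ⟨c, hc, h⟩ := Literature.Analysis.FluidPDE.exists_norm_fderiv_smoothTransition_cutoff_le (E := ℝ)
  refine ⟨c, hc, fun R hR ξ => ?_⟩
  have h1 := h R hR ξ
  rw [← cutoff_eq] at h1
  rw [← Real.norm_eq_abs, ← fderiv_apply_one_eq_deriv]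
  calc ‖(fderiv ℝ (cutoff R) ξ) 1‖ ≤ ‖fderiv ℝ (cutoff R) ξ‖ * ‖(1 : ℝ)‖ := ContinuousLinearMap.le_opNorm _ _
    _ = ‖fderiv ℝ (cutoff R) ξ‖ := by simp
    _ ≤ c / R := h1

/-- `χ_R` has derivative `deriv χ_R` everywhere, and `deriv χ_R` is continuous. [folklore] -/
theorem hasDerivAt_cutoff (R ξ : ℝ) : HasDerivAt (cutoff R) (deriv (cutoff R) ξ) ξ ∧ Continuous (deriv (cutoff R)) :=
  ⟨((contDiff_cutoff R).differentiable one_ne_zero ξ).hasDerivAt, (contDiff_cutoff R).continuous_deriv le_rfl⟩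

/-! ### §3 The product rule in primitive form -/

/-- **Product rule in primitive form.** For `χ ∈ C¹` and `u = u(0) + ∫₀u₁` with `u₁ ∈ L²`:
`χ(x)u(x) = χ(0)u(0) + ∫₀ˣ (χ′u + χu₁)` at every `x` (both factors are absolutely continuous on `[[0, x]]`; `u′ = u₁` a.e. by Lebesgue
differentiation). [folklore] -/
theorem primitive_mul {χ u u₁ : ℝ → ℝ} (hχ : ContDiff ℝ 1 χ) (hu : ∀ x, u x = u 0 + ∫ s in (0 : ℝ)..x, u₁ s)
    (hu₁ : MemLp u₁ 2 volume) (x : ℝ) :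
    χ x * u x = χ 0 * u 0 + ∫ s in (0 : ℝ)..x, (deriv χ s * u s + χ s * u₁ s) := by
  have hii : ∀ a b, IntervalIntegrable u₁ volume a b := intervalIntegrable_of_memLp_two hu₁
  have hχac : AbsolutelyContinuousOnInterval χ 0 x := hχ.contDiffOn.absolutelyContinuousOnInterval
  have huac : AbsolutelyContinuousOnInterval u 0 x := absolutelyContinuousOnInterval_of_primitive hu hii 0 x
  have h := hχac.integral_deriv_mul_eq_sub huac
  have hder : ∀ᵐ y : ℝ, HasDerivAt u (u₁ y) y := by
    filter_upwards [_root_.LocallyIntegrable.ae_hasDerivAt_integral (hu₁.locallyIntegrable one_le_two)] with y hy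
    have e : u = fun x => u 0 + ∫ s in (0 : ℝ)..x, u₁ s := funext hu
    rw [e]
    exact (hy 0).const_add _
  have hcongr : ∫ s in (0 : ℝ)..x, (deriv χ s * u s + χ s * deriv u s) =
      ∫ s in (0 : ℝ)..x, (deriv χ s * u s + χ s * u₁ s) :=
    intervalIntegral.integral_congr_ae (hder.mono fun y hy _ => by rw [hy.deriv])
  rw [← hcongr, h]
  ring

/-! ### §4 The cutoff tests `χ_R u` -/

/-- **`χ_R u` is a compactly supported test** for `u` odd in primitive form with `u, u₁ ∈ L²` (`R > 0`): with
`v = χ_R u`, `v₁ = χ_R′u + χ_R u₁`, the pair `(v, v₁)` satisfies `IsCompactTest`, and `v, v₁` vanish where `2R ≤ |ξ|`. [folklore] -/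
theorem isCompactTest_cutoff_mul {u u₁ : ℝ → ℝ} {R : ℝ} (hR : 0 < R) (hu : ∀ x, u x = u 0 + ∫ s in (0 : ℝ)..x, u₁ s)
    (hodd : ∀ y, u (-y) = -u y) (hu₁ : MemLp u₁ 2 volume) (hu2 : MemLp u 2 volume) :
    IsCompactTest (fun ξ => cutoff R ξ * u ξ) (fun ξ => deriv (cutoff R) ξ * u ξ + cutoff R ξ * u₁ ξ) ∧
      ∀ x, 2 * R ≤ |x| → cutoff R x * u x = 0 ∧ deriv (cutoff R) x * u x + cutoff R x * u₁ x = 0 := by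
  obtain ⟨M, hM0, hM⟩ := exists_deriv_cutoff_le
  have hχc : Continuous (cutoff R) := (contDiff_cutoff R).continuous
  have hχ'c : Continuous (deriv (cutoff R)) := (hasDerivAt_cutoff R 0).2
  have hii : ∀ a b, IntervalIntegrable u₁ volume a b := intervalIntegrable_of_memLp_two hu₁
  have huc : Continuous u := continuous_of_primitive hu hii
  have hsupp : ∀ x, 2 * R ≤ |x| → cutoff R x * u x = 0 ∧ deriv (cutoff R) x * u x + cutoff R x * u₁ x = 0 := by
    intro x hx
    obtain ⟨h1, h2⟩ := cutoff_and_deriv_eq_zero hR hx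
    simp [h1, h2]
  refine ⟨⟨fun x => ?_, fun y => ?_, ?_, ⟨2 * R, hsupp⟩⟩, hsupp⟩
  · -- primitive form
    have h := primitive_mul (contDiff_cutoff R) hu hu₁ x
    simpa using h
  · -- odd
    simp only [cutoff_neg, hodd, mul_neg]
  · -- `v₁ ∈ L²`: `v₁² ≤ 2((M/R)²u² + u₁²)`
    have hm : AEStronglyMeasurable (fun ξ => deriv (cutoff R) ξ * u ξ + cutoff R ξ * u₁ ξ) volume :=
      (hχ'c.aestronglyMeasurable.mul huc.aestronglyMeasurable).add (hχc.aestronglyMeasurable.mul hu₁.1)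
    rw [memLp_two_iff_integrable_sq hm]
    refine (((hu2.integrable_sq.const_mul ((M / R) ^ 2)).add hu₁.integrable_sq).const_mul 2).mono' (hm.pow 2)
      (Eventually.of_forall fun ξ => ?_)
    rw [Real.norm_eq_abs, abs_of_nonneg (sq_nonneg _)]
    simp only [Pi.add_apply]
    have h1 : (deriv (cutoff R) ξ * u ξ) ^ 2 ≤ (M / R) ^ 2 * u ξ ^ 2 := by
      rw [mul_pow, ← sq_abs (deriv (cutoff R) ξ)]
      exact mul_le_mul_of_nonneg_right (pow_le_pow_left₀ (abs_nonneg _) (hM R hR ξ) 2) (sq_nonneg _)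
    have h2 : (cutoff R ξ * u₁ ξ) ^ 2 ≤ u₁ ξ ^ 2 := by
      rw [mul_pow]
      obtain ⟨h0, h1'⟩ := cutoff_nonneg_le_one R ξ
      have : cutoff R ξ ^ 2 ≤ 1 := by nlinarith
      nlinarith [sq_nonneg (u₁ ξ)]
    nlinarith [sq_nonneg (deriv (cutoff R) ξ * u ξ - cutoff R ξ * u₁ ξ)]

/-- The cutoff test is again in the (odd, `L²`) class, so the construction iterates: `χ_R u ∈ L²` and `χ_R′u + χ_R u₁ ∈ L²`. [folklore] -/
theorem memLp_cutoff_mul {u u₁ : ℝ → ℝ} {R : ℝ} (hR : 0 < R) (hu : ∀ x, u x = u 0 + ∫ s in (0 : ℝ)..x, u₁ s)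
    (hodd : ∀ y, u (-y) = -u y) (hu₁ : MemLp u₁ 2 volume) (hu2 : MemLp u 2 volume) :
    MemLp (fun ξ => cutoff R ξ * u ξ) 2 volume ∧ MemLp (fun ξ => deriv (cutoff R) ξ * u ξ + cutoff R ξ * u₁ ξ) 2 volume := by
  refine ⟨?_, (isCompactTest_cutoff_mul hR hu hodd hu₁ hu2).1.memLp⟩
  have hχc : Continuous (cutoff R) := (contDiff_cutoff R).continuous
  have hm : AEStronglyMeasurable (fun ξ => cutoff R ξ * u ξ) volume := hχc.aestronglyMeasurable.mul hu2.1
  rw [memLp_two_iff_integrable_sq hm]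
  refine hu2.integrable_sq.mono' (hm.pow 2) (Eventually.of_forall fun ξ => ?_)
  rw [Real.norm_eq_abs, abs_of_nonneg (sq_nonneg _), mul_pow]
  obtain ⟨h0, h1⟩ := cutoff_nonneg_le_one R ξ
  have : cutoff R ξ ^ 2 ≤ 1 := by nlinarith
  nlinarith [sq_nonneg (u ξ)]

/-- **`χ_R² u` is a compactly supported test**: with `v = χ_R u`, `v₁ = χ_R′u + χ_R u₁` and `φ = χ_R v`, `φ₁ = χ_R′v + χ_R v₁`, the pair
`(φ, φ₁)` satisfies `IsCompactTest` (`R > 0`). [folklore] -/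
theorem isCompactTest_cutoff_sq_mul {u u₁ : ℝ → ℝ} {R : ℝ} (hR : 0 < R) (hu : ∀ x, u x = u 0 + ∫ s in (0 : ℝ)..x, u₁ s)
    (hodd : ∀ y, u (-y) = -u y) (hu₁ : MemLp u₁ 2 volume) (hu2 : MemLp u 2 volume) :
    IsCompactTest (fun ξ => cutoff R ξ * (cutoff R ξ * u ξ))
      (fun ξ => deriv (cutoff R) ξ * (cutoff R ξ * u ξ) + cutoff R ξ * (deriv (cutoff R) ξ * u ξ + cutoff R ξ * u₁ ξ)) := by
  obtain ⟨hv, -⟩ := isCompactTest_cutoff_mul hR hu hodd hu₁ hu2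
  obtain ⟨hv2, hv₁2⟩ := memLp_cutoff_mul hR hu hodd hu₁ hu2
  have hv0 : ∀ x, cutoff R x * u x = cutoff R 0 * u 0 + ∫ s in (0 : ℝ)..x, (deriv (cutoff R) s * u s + cutoff R s * u₁ s) := by
    intro x
    have h := hv.primitive x
    simpa using h
  exact (isCompactTest_cutoff_mul (u := fun ξ => cutoff R ξ * u ξ)
    (u₁ := fun ξ => deriv (cutoff R) ξ * u ξ + cutoff R ξ * u₁ ξ) hR hv0 hv.odd hv₁2 hv2).1

end SheetRLinearisedTests
end Summit.NavierStokesRegularity.OSWSelfSimilar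

end
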